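import Mathlib
import Summits.Ventures.PercRepro2.ZMeanProof
import Summits.Ventures.PercRepro2.PendantRoot
import Summits.Ventures.PercRepro2.A3LeafQuadratic
import Summits.Ventures.PercRepro2.HMFLeaf
import Summits.Ventures.PercRepro2.HMFPendantBEvents
import Summits.Ventures.PercRepro2.HMFPendantB
import Summits.Ventures.PercRepro2.HMFLeafStep
import Summits.Ventures.PercRepro2.HMFLeafIso
import Summits.Ventures.PercRepro2.HMFLeafRB
import Summits.Ventures.PercRepro2.HMFSureEdge

/-!
# The (HMF) leaf step with the contracted instance read at the attachment vertex
(blind cell PercRepro2, night-1 g7)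

`HMFLeafStep.HMF_of_leaf_first_order` needs (HMF) at the contracted instance `p[f ↦ 1]` with the
mark `a₃`; by `HMFSureEdge.HMFc_relabel_of_sure` this is the instance with the mark `u` (the
attachment vertex), so the leaf step reads: (HMF) at a leaf `a₃` at `u` follows from (HMF) at `u` in
`p[f ↦ 1]` and the first-order inequality — `HMF_of_leaf_relabel`.
-/

namespace Summit.Ventures.PercRepro2

open UnionCluster CovForm PendantRoot

namespace HMFLeafStep

variable {V : Type*} {E : Type*} [Fintype E] [DecidableEq E] [Fintype V] [DecidableEq V]
  {R : Type*} [Field R] [LinearOrder R] [IsStrictOrderedRing R]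

variable (p : E → R) (ends : E → Sym2 V) {f : E} {a₃ y : V}

/-- **The (HMF) leaf step, read at the attachment vertex**: (HMF) at a leaf `a₃` (edge `f = {a₃, y}`)
follows from (HMF) for the mark `y` in `p[f ↦ 1]` and `HMFc(p[f ↦ 1]; y) ≤ 4 HMFc(p[f ↦ ½]; a₃)`. -/
theorem HMF_of_leaf_relabel (hp : IsProbVec p) (hf : ends f = s(a₃, y))
    (hleaf : ∀ e, a₃ ∈ ends e → e = f) (h3y : a₃ ≠ y) {o a₁ a₂ b : V} (h31 : a₃ ≠ a₁) (h32 : a₃ ≠ a₂)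
    (ho : o ≠ a₃) (hb : b ≠ a₃)
    (hcontract : HMF (Function.update p f 1) ends o a₁ a₂ y b)
    (hfirst : HMFc (Function.update p f 1) ends o a₁ a₂ y b ≤
      4 * HMFc (Function.update p f (1 / 2)) ends o a₁ a₂ a₃ b) :
    HMF p ends o a₁ a₂ a₃ b := by
  have hrel := HMFSureEdge.HMFc_relabel_of_sure (Function.update p f 1) ends
    (hp.update f zero_le_one le_rfl) hf (by simp) o a₁ a₂ b
  refine HMF_of_leaf_first_order p ends hp hf hleaf h3y h31 h32 ho hb ?_ ?_
  · rw [hrel]; exact hcontract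
  · rw [hrel]; exact hfirst

/-- The same with the concavity hypothesis `κ ≥ 0` (`HMF_of_leaf_step`), the contracted instance read
at the attachment vertex. -/
theorem HMF_of_leaf_step_relabel (hp : IsProbVec p) (hf : ends f = s(a₃, y))
    (hleaf : ∀ e, a₃ ∈ ends e → e = f) (h3y : a₃ ≠ y) {o a₁ a₂ b : V} (h31 : a₃ ≠ a₁) (h32 : a₃ ≠ a₂)
    (ho : o ≠ a₃) (hb : b ≠ a₃)
    (hcontract : HMF (Function.update p f 1) ends o a₁ a₂ y b)
    (hkappa : 0 ≤ 4 * HMFc (Function.update p f (1 / 2)) ends o a₁ a₂ a₃ b -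
      2 * HMFc (Function.update p f 1) ends o a₁ a₂ y b) :
    HMF p ends o a₁ a₂ a₃ b := by
  have hrel := HMFSureEdge.HMFc_relabel_of_sure (Function.update p f 1) ends
    (hp.update f zero_le_one le_rfl) hf (by simp) o a₁ a₂ b
  refine HMF_of_leaf_step p ends hp hf hleaf h3y h31 h32 ho hb ?_ ?_
  · rw [hrel]; exact hcontract
  · rw [hrel]; exact hkappa

end HMFLeafStep

end Summit.Ventures.PercRepro2
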